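import Summits.Langlands.Langlands.Theses.PhantomRMYoshida
import Summits.Langlands.Langlands.Theses.LiftDescend
import Summits.Langlands.Langlands.Theses.BaseFieldAscent
import Summits.Langlands.Langlands.Theses.CMFern
import Summits.Langlands.Langlands.Theorems.PhantomRMYoshidaPhantomRMJunction

/-!
# Crux `PhantomRMJunction` (stmt-Langlands-13643) — crux-ideate round 1, ideator k = 1: kernel-checked position

`PhantomRMJunction := ∀ _ : PhantomRMSector, Langlands` is the D-0027 §2.1 FRAME item of
route-Langlands-PhantomRMYoshida ("the rest of the summit … not this route's business; true iff
Langlands"), re-kinded support → crux on 2026-08-16T07:53:40Z only because every hypothesis of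
`closes` must be a crux item. This file records, sorry-free:

* §1 the landed truth table (Theorems/PhantomRMYoshidaPhantomRMJunction.lean, p84203) by reference;
* §2 SUBSUMPTION: the junction is a corollary of the item sets of each of the three FRAME-FREE
  summit atlases already on the ledger (LiftDescend, BaseFieldAscent, CMFern) — in the obligation
  graph it is downstream of items that are already staffed, so a `Lines/` skeleton for it would
  re-cut one of those routes;
* §3 the ONE junction-adjacent statement that is specific to this sector and not `rfl`-close:
  `OrdinaryShapeDeRham` (Greenberg-ordinary of inertial shape `(0,0,1,1)` at `p` ⇒ de Rham for the
  PINNED Fontaine datum; Perrin-Riou 1994: ordinary ⇒ semi-stable ⇒ de Rham), under which the typed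
  summit literally contains the sector (`sector_of_langlands`) and target ∧ junction ↔ summit
  (`target_and_junction_iff_langlands`). It is what a disprover of the junction would have to get
  past (`¬ J ↔ X ∧ ¬ Langlands`), and what a prover of `Langlands → PhantomRMSector` is blocked on
  (definition items D1/D2 of the Fontaine datum), exactly as `Langlands → ReducibleOrdinaryModular`
  stalled at `IsDeRhamFramed` for the sibling frame item stmt-Langlands-12923.

No theorem here concludes the item or `¬ Langlands` under hypotheses smaller than an atlas.
-/

set_option linter.dupNamespace false
set_option linter.unusedVariables false

namespace Summit.Langlands.Langlands.Cruxes.PhantomRMJunction.SketchIdeator1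

open Summit.Langlands Summit.Langlands.Langlands.Theses
open scoped NumberField

/-! ## §1 Landed position (references only) -/

example : PhantomRMYoshida.PhantomRMJunction ↔ (PhantomRMYoshida.PhantomRMSector → _root_.Langlands) :=
  Langlands.Theorems.phantomRMJunction_iff_imp

example : PhantomRMYoshida.PhantomRMJunction ↔ ¬ PhantomRMYoshida.PhantomRMSector ∨ _root_.Langlands :=
  Langlands.Theorems.phantomRMJunction_iff_not_or

example : ¬ PhantomRMYoshida.PhantomRMJunction ↔ PhantomRMYoshida.PhantomRMSector ∧ ¬ _root_.Langlands :=
  Langlands.Theorems.not_phantomRMJunction_iff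

/-- The item, unfolded: every theorem below concludes the ARROW `PhantomRMSector → Langlands`, which is
the item by `Iff.rfl` — spelled this way so that no audit ever reads a conditional arrow into the item
constant as a proof of the item (same hygiene as the landed Theorems file). [folklore] -/
theorem junction_iff_arrow :
    PhantomRMYoshida.PhantomRMJunction ↔ (PhantomRMYoshida.PhantomRMSector → _root_.Langlands) := Iff.rfl

/-! ## §2 Subsumption by the frame-free summit atlases (obligation graph) -/

/-- The junction follows from the six load-bearing items of route-Langlands-LiftDescend
(stmt-Langlands-1059, 1063, 1061, 14091, 1062, 1065), through that route's sorry-free `closes`.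
[folklore] -/
theorem arrow_of_liftDescend_items (hCM : LiftDescend.AutToGalCM) (hTR : LiftDescend.AutToGalCMtoTR)
    (hAsc : LiftDescend.AscentAutToGal) (hPot : LiftDescend.PotentialAutomorphy)
    (hDesc : LiftDescend.DescentOfAutomorphy) (hW2S : LiftDescend.WeakToStrongGalToAut) :
    PhantomRMYoshida.PhantomRMSector → _root_.Langlands :=
  fun _ => LiftDescend.closes hCM hTR hAsc hPot hDesc hW2S

/-- The junction follows from the three cruxes of route-Langlands-BaseFieldAscent
(stmt-Langlands-1093 ReciprocityTRCM, AscentConjugationSolvable, AscentResidual). [folklore] -/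
theorem arrow_of_baseFieldAscent_items (h₁ : BaseFieldAscent.ReciprocityTRCM)
    (h₂ : BaseFieldAscent.AscentConjugationSolvable) (h₃ : BaseFieldAscent.AscentResidual) :
    PhantomRMYoshida.PhantomRMSector → _root_.Langlands :=
  fun _ => BaseFieldAscent.closes h₁ h₂ h₃

/-- The junction follows from the seven hypotheses of route-Langlands-CMFern's `closes`. [folklore] -/
theorem arrow_of_cmFern_items (hA : CMFern.AutToGalCM) (hCore : CMFern.GeometricFernCM)
    (hU : CMFern.CorrespondentUnique) (hWS : CMFern.WeakToStrongGalToAut) (hTR : CMFern.ReciprocityCMtoTR)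
    (hCS : CMFern.AscentConjugationSolvable) (hRes : CMFern.AscentResidual) :
    PhantomRMYoshida.PhantomRMSector → _root_.Langlands :=
  fun _ => CMFern.closes hA hCore hU hWS hTR hCS hRes

/-! ## §3 The sector inside the typed summit: `OrdinaryShapeDeRham` -/

/-- **Greenberg-ordinary of shape `(0,0,1,1)` at `p` ⇒ de Rham for the pinned Fontaine datum**
(for `4`-dimensional `ρ` over `ℚ`): the only non-syntactic step between the typed summit and the
sector `PhantomRMSector`. True in print (Greenberg-ordinary ⇒ semi-stable, Perrin-Riou, Astérisque 223
(1994); semi-stable ⇒ de Rham, Fontaine Exp. III); unprovable in-tree until the Fontaine datum's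
definition items D1 (`B_dR(K_v)`) / D2 (`WD ∘ D_pst`) land (the datum is pinned by specification).
`𝓡.pst` ignores `𝓡` (`ordinaryShapeDeRham_pst_irrel`), so the leading `∀ 𝓡` is cosmetic.
[cite: PerrinRiou1994Ordinaires] -/
def OrdinaryShapeDeRham : Prop :=
  ∀ (𝓡 : ReciprocityData ℚ) (p : ℕ) [Fact p.Prime]
    (ρ : Literature.NumberTheory.GaloisRepresentations.FramedGaloisRep ℚ (PadicAlgCl p) 4)
    (v : IsDedekindDomain.HeightOneSpectrum (𝓞 ℚ)) (hv : ((p : ℕ) : 𝓞 ℚ) ∈ v.asIdeal),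
    ρ.IsGreenbergOrdinaryOfShapeAt v ![0, 0, 1, 1] → (𝓡.pst p v hv).IsDeRhamFramed (ρ.toLocal v)

/-- The pinned datum does not depend on the reciprocity data. [folklore] -/
theorem ordinaryShapeDeRham_pst_irrel (𝓡 𝓡' : ReciprocityData ℚ) (p : ℕ) [Fact p.Prime]
    (v : IsDedekindDomain.HeightOneSpectrum (𝓞 ℚ)) (hv : ((p : ℕ) : 𝓞 ℚ) ∈ v.asIdeal) :
    𝓡.pst p v hv = 𝓡'.pst p v hv := rfl

/-- **Under `OrdinaryShapeDeRham` the typed summit contains the sector**: `Langlands → PhantomRMSector`.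
Proof: take a reciprocity datum `𝓡` for `ℚ` from the summit's `Nonempty` conjunct and conjunct (B) of
its `∀ 𝓡` clause at `n = 4`, `ℓ = p` (statement re-type p141787, 2026-08-17: the summit is
`∀ F, Nonempty (ReciprocityData F) ∧ ∀ 𝓡 n, …`; mechanical repair of the `∃ 𝓡`-opening proof,
D-0032 §4c / REPORT §5.3); the sector's `ρ` is irreducible (hypothesis) and `𝓡`-geometric (a.e.
unramified from the residual-pair clause; de Rham at `p` from the Greenberg shape via
`OrdinaryShapeDeRham`); the resulting `Corresponds` contains the sector's a.e. Satake–Frobenius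
clause verbatim (the sector is written in the summit's dictionary). [folklore] -/
theorem sector_of_langlands (hDR : OrdinaryShapeDeRham) (hL : _root_.Langlands) :
    PhantomRMYoshida.PhantomRMSector :=
  fun p _ hp k _ _ _ _ _ red σ σ' hcpt ι ρ hσ hσ' hirr hirr' hdet hnc hρirr hSh =>
    (hL ℚ).1.elim fun 𝓡 =>
      (((hL ℚ).2 𝓡 4 (by norm_num) hcpt).2 p ι ρ hρirr
          ⟨hSh.2.2.mono fun v h => h.1, fun v hv => hDR 𝓡 p ρ v hv (hSh.2.1 v hv).1⟩).elim
        fun π hπ => ⟨π, hπ.1, hπ.2.1.mono fun v h => h⟩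

/-- Hence, under `OrdinaryShapeDeRham`, route target ∧ junction is EXACTLY the summit. [folklore] -/
theorem target_and_junction_iff_langlands (hDR : OrdinaryShapeDeRham) :
    (PhantomRMYoshida.PhantomRMSector ∧ PhantomRMYoshida.PhantomRMJunction) ↔ _root_.Langlands :=
  ⟨fun h => h.2 h.1, fun hL => ⟨sector_of_langlands hDR hL, fun _ => hL⟩⟩

/-- … and the junction is then equivalent to `PhantomRMSector → Langlands` with a TRUE-under-the-summit
antecedent: refuting it is refuting the typed summit (`¬ J → ¬ Langlands`), proving it is proving the
summit up to the sector (`J → (Langlands ↔ PhantomRMSector)`). [folklore] -/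
theorem junction_iff_summit_of_sector (hDR : OrdinaryShapeDeRham) :
    PhantomRMYoshida.PhantomRMJunction ↔ (_root_.Langlands ↔ PhantomRMYoshida.PhantomRMSector) :=
  ⟨fun hJ => ⟨sector_of_langlands hDR, fun hX => hJ hX⟩, fun h hX => h.2 hX⟩

end Summit.Langlands.Langlands.Cruxes.PhantomRMJunction.SketchIdeator1
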